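import Literature.RingTheory.FormalGroups.LazardRingLinearisation
import HarnessLib

/-!
# Generators of the Lazard ring: `L` is generated by one element in each weight
# ([Lazard1955] §II Thm. II, §III; [Hazewinkel1978] §5.3–5.5)

Topic `Literature/RingTheory/FormalGroups`; namespace `Literature.RingTheory.FormalGroups`.  Plumbing definitions
(`LazardRing.genSubring`, `LazardRing.tail`, `LazardRing.bezout`, `LazardRing.tGen`, `LazardRing.genHom`) and fully
proved theorems; no named fact, no instance, no notation, no `sorry`.

From the linearisation (`LazardRingLinearisation`: for `0 < i < m` a Lazard relation with linear part
`δᵢ − c_{m,i} Σ_b w_b δ_b` in degree `m`) and the weight grading (`LazardRingGrading`: its weight-`(m−1)` component is again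
a relation) we read off, IN THE LAZARD RING `L`, Lazard's congruence
`ā_{(i,m−i)} ≡ c_{m,i} · t_m (mod the subring generated by the ā_d of lower degree)` with `t_m = Σ_b w_b ā_{(b,m−b)}`
(`LazardRing.gen_sub_smul_tGen_mem_genSubring`; the decomposables of weight `m − 1` are products of generators of lower
weight, `LazardRing.tail_mem_genSubring`).  Consequently the ring map `θ : ℤ[T₀, T₁, …] → L`, `T_k ↦ t_{k+2}`
(`LazardRing.genHom`) is SURJECTIVE (`LazardRing.genHom_surjective`): the Lazard ring is generated by one element `t_m` in
each weight `m − 1 ≥ 1`.  (Injectivity — Lazard's theorem proper — is the sibling `LazardRingPolynomial`.)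

## References
* [Lazard1955] M. Lazard, *Sur les groupes de Lie formels à un paramètre*, Bull. SMF 83 (1955), §II Thm. II, §III.
* [Hazewinkel1978] M. Hazewinkel, *Formal Groups and Applications* (1978), §5.3–§5.5.
-/

noncomputable section

namespace Literature.RingTheory.FormalGroups

open _root_.MvPowerSeries (coeff)
open Finset
open MvPolynomial (IsWeightedHomogeneous weightedHomogeneousComponent)

namespace LazardRing

/-! ## §1 The subring of lower degree -/

/-- The subring `S_{<m} ⊆ L` generated by the generators `ā_d` of degree `|d| < m` (weights `< m − 1`).
[cite: Lazard1955, §III] -/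
def genSubring (m : ℕ) : Subring LazardRing :=
  Subring.closure {x | ∃ d : Fin 2 →₀ ℕ, Finsupp.degree d < m ∧ x = gen d}

/-- Generators of lower degree lie in `S_{<m}`. [cite: Lazard1955, §III] -/
theorem gen_mem_genSubring {m : ℕ} {d : Fin 2 →₀ ℕ} (h : Finsupp.degree d < m) : gen d ∈ genSubring m :=
  Subring.subset_closure ⟨d, h, rfl⟩

/-- Idle generators (which vanish) lie in every `S_{<m}`. [cite: Lazard1955, §III] -/
theorem gen_mem_genSubring_of_not_interior (m : ℕ) {d : Fin 2 →₀ ℕ} (hd : ¬(0 < d 0 ∧ 0 < d 1)) :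
    gen d ∈ genSubring m := by
  rw [gen_of_not_interior hd]; exact (genSubring m).zero_mem

/-- The class of a monomial: `mk (c · Π a_d^{α_d}) = c · Π ā_d^{α_d}`. [cite: Lazard1955, §II] -/
theorem mk_monomial (α : (Fin 2 →₀ ℕ) →₀ ℕ) (c : ℤ) :
    Ideal.Quotient.mk lazardIdeal (MvPolynomial.monomial α c) = (c : LazardRing) * ∏ d ∈ α.support, gen d ^ α d := by
  rw [MvPolynomial.monomial_eq, map_mul, eq_intCast MvPolynomial.C c, map_intCast, Finsupp.prod, map_prod]
  simp_rw [map_pow]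
  rfl

/-- A degree: `|d| = d₀ + d₁` (plumbing; the tree's `Literature.NumberTheory.EllipticCurves.finsupp_degree_fin_two`, kept
private here to avoid importing the elliptic-curve files). [folklore] -/
private theorem degree_fin_two (d : Fin 2 →₀ ℕ) : Finsupp.degree d = d 0 + d 1 := by
  rw [Finsupp.degree_eq_sum, Fin.sum_univ_two]

/-! ## §2 The tail of a polynomial of weight `m − 1` lies in `S_{<m}` -/

/-- The **tail** of `r ∈ ℤ[a]` in degree `m`: its class in `L` minus its linear part `Σ_{0<b<m} r_{(b,m−b)} · ā_{(b,m−b)}`.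
[cite: Lazard1955, §III] -/
def tail (m : ℕ) (r : LazardGen) : LazardRing :=
  Ideal.Quotient.mk lazardIdeal r - ∑ b ∈ Ioo 0 m, linPart m r b • gen (Finsupp.single 0 b + Finsupp.single 1 (m - b))

/-- The tail is additive. [cite: Lazard1955, §III] -/
theorem tail_add (m : ℕ) (r s : LazardGen) : tail m (r + s) = tail m r + tail m s := by
  simp only [tail, map_add, linPart_add, Pi.add_apply, add_smul, sum_add_distrib]
  abel

/-- The tail of a finite sum. [cite: Lazard1955, §III] -/
theorem tail_sum (m : ℕ) {ι : Type*} (S : Finset ι) (r : ι → LazardGen) :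
    tail m (∑ i ∈ S, r i) = ∑ i ∈ S, tail m (r i) := by
  classical
  induction S using Finset.induction_on with
  | empty => simp [tail]
  | insert a S ha ih => rw [sum_insert ha, sum_insert ha, tail_add, ih]

/-- Linear part of a monomial: `c` on the degree-one monomial `a_{(b,m−b)}`, else `0`. [cite: Lazard1955, §III] -/
theorem linPart_monomial (m : ℕ) (α : (Fin 2 →₀ ℕ) →₀ ℕ) (c : ℤ) (b : ℕ) :
    linPart m (MvPolynomial.monomial α c) b =
      if 0 < b ∧ b < m ∧ α = Finsupp.single (Finsupp.single 0 b + Finsupp.single 1 (m - b)) 1 then c else 0 := by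
  classical
  unfold linPart
  rw [MvPolynomial.coeff_monomial]
  by_cases hb : 0 < b ∧ b < m
  · rw [if_pos hb]
    by_cases hα : α = Finsupp.single (Finsupp.single 0 b + Finsupp.single 1 (m - b)) 1
    · rw [if_pos hα, if_pos ⟨hb.1, hb.2, hα⟩]
    · rw [if_neg hα, if_neg (fun h => hα h.2.2)]
  · rw [if_neg hb, if_neg (fun h => hb ⟨h.1, h.2.1⟩)]

/-- **The tail of the degree-one monomial `c · a_{(b, m−b)}` vanishes** (`0 < b < m`). [cite: Lazard1955, §III] -/
theorem tail_monomial_single {m b : ℕ} (hb : 0 < b) (hbm : b < m) (c : ℤ) :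
    tail m (MvPolynomial.monomial (Finsupp.single (Finsupp.single 0 b + Finsupp.single 1 (m - b)) 1) c) = 0 := by
  classical
  rw [tail, mk_monomial, Finsupp.support_single _ one_ne_zero, prod_singleton, Finsupp.single_eq_same, pow_one]
  simp_rw [linPart_monomial]
  rw [sum_eq_single_of_mem b (mem_Ioo.mpr ⟨hb, hbm⟩)]
  · rw [if_pos ⟨hb, hbm, rfl⟩, zsmul_eq_mul, sub_self]
  · intro b' hb' hne
    rw [mem_Ioo] at hb'
    rw [if_neg, zero_smul]
    rintro ⟨_, _, h⟩
    have h' := congrArg (fun f => (f (Finsupp.single 0 b + Finsupp.single 1 (m - b)) : ℕ)) h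
    simp only [Finsupp.single_eq_same, Finsupp.single_apply] at h'
    split_ifs at h' with hh
    · exact hne (by simpa using congrArg (fun e => e 0) hh)

/-- For a monomial `α` all of whose variables are interior, every variable has weight at most
`weight(α) − (deg α − 1)`: `(|d| − 1) + (deg α − 1) ≤ weight α`. [cite: Lazard1955, §II (2.6)] -/
theorem lazardWeight_add_degree_le_weight {α : (Fin 2 →₀ ℕ) →₀ ℕ}
    (hα : ∀ d ∈ α.support, 0 < d 0 ∧ 0 < d 1) {d : Fin 2 →₀ ℕ} (hd : d ∈ α.support) :
    lazardWeight d + ((Finsupp.degree α : ℕ) : ℤ) - 1 ≤ Finsupp.weight lazardWeight α := by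
  classical
  rw [Finsupp.weight_apply, Finsupp.sum, Finsupp.degree_apply, Nat.cast_sum]
  -- `Σ α_d' (w d' - 1) ≥ α_d (w d - 1) ≥ w d - 1`
  have hw : ∀ d' ∈ α.support, (0 : ℤ) ≤ lazardWeight d' - 1 + 1 - 1 := by
    intro d' hd'
    have h := hα d' hd'
    simp only [lazardWeight, degree_fin_two]; push_cast; omega
  have key : lazardWeight d - 1 ≤ ∑ d' ∈ α.support, ((α d' : ℤ) * lazardWeight d' - (α d' : ℤ)) := by
    have hterm : ∀ d' ∈ α.support, (0 : ℤ) ≤ (α d' : ℤ) * lazardWeight d' - (α d' : ℤ) := by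
      intro d' hd'
      have h1 : (1 : ℤ) ≤ α d' := by exact_mod_cast Nat.one_le_iff_ne_zero.mpr (Finsupp.mem_support_iff.mp hd')
      have h2 := hw d' hd'
      nlinarith
    have hle := single_le_sum hterm hd
    have h1 : (1 : ℤ) ≤ α d := by exact_mod_cast Nat.one_le_iff_ne_zero.mpr (Finsupp.mem_support_iff.mp hd)
    have h2 := hw d hd
    nlinarith
  have hsplit : ∑ d' ∈ α.support, ((α d' : ℤ) * lazardWeight d' - (α d' : ℤ)) =
      ∑ d' ∈ α.support, (α d' : ℤ) • lazardWeight d' - ∑ d' ∈ α.support, (α d' : ℤ) := by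
    rw [← sum_sub_distrib]; simp_rw [smul_eq_mul]
  rw [hsplit] at key
  simp_rw [Nat.cast_smul_eq_nsmul] at key
  linarith

/-- **The tail of a monomial of weight `m − 1` lies in `S_{<m}`** (`m ≥ 2`). [cite: Lazard1955, §III] -/
theorem tail_monomial_mem_genSubring {m : ℕ} {α : (Fin 2 →₀ ℕ) →₀ ℕ}
    (hα : Finsupp.weight lazardWeight α = (m : ℤ) - 1) (c : ℤ) :
    tail m (MvPolynomial.monomial α c) ∈ genSubring m := by
  classical
  by_cases hA : ∃ b, 0 < b ∧ b < m ∧ α = Finsupp.single (Finsupp.single 0 b + Finsupp.single 1 (m - b)) 1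
  · obtain ⟨b, hb, hbm, rfl⟩ := hA
    rw [tail_monomial_single hb hbm]; exact (genSubring m).zero_mem
  · -- no linear part; the class is `c · Π ā_d^{α_d}`
    have hlin : ∀ b, linPart m (MvPolynomial.monomial α c) b = 0 := fun b => by
      rw [linPart_monomial, if_neg (fun h => hA ⟨b, h⟩)]
    rw [tail]
    simp_rw [hlin, zero_smul, sum_const_zero, sub_zero]
    rw [mk_monomial]
    by_cases hint : ∀ d' ∈ α.support, 0 < d' 0 ∧ 0 < d' 1
    · -- all variables interior: each has degree `< m`
      refine (genSubring m).mul_mem (intCast_mem (genSubring m) c) (Subring.prod_mem _ fun d hd => Subring.pow_mem _ ?_ _)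
      refine gen_mem_genSubring ?_
      have hle := lazardWeight_add_degree_le_weight hint hd
      rw [hα] at hle
      -- `deg α ≥ 2`: otherwise `α` is a single interior variable of degree `m`, i.e. of the excluded form
      have hdeg : 2 ≤ Finsupp.degree α := by
        by_contra hlt
        have hαd : α d ≠ 0 := Finsupp.mem_support_iff.mp hd
        have h1 : α d ≤ Finsupp.degree α := by
          rw [Finsupp.degree_apply]; exact single_le_sum (fun _ _ => Nat.zero_le _) hd
        have hα1 : α = Finsupp.single d 1 := by
          have hαd1 : α d = 1 := by omega
          ext d'
          by_cases hdd : d' = d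
          · subst hdd; simp [hαd1]
          · rw [Finsupp.single_apply, if_neg (fun h => hdd h.symm)]
            by_contra hne
            have hd' : d' ∈ α.support := Finsupp.mem_support_iff.mpr hne
            have h2 : α d + α d' ≤ Finsupp.degree α := by
              rw [Finsupp.degree_apply]
              exact add_le_sum (fun _ _ => Nat.zero_le _) hd hd' (Ne.symm hdd)
            have : 0 < α d' := Nat.pos_of_ne_zero hne
            omega
        -- weight of `single d 1` is `w d = |d| - 1 = m - 1`, so `|d| = m` and `α` is of the excluded form
        apply hA
        have hwd : lazardWeight d = (m : ℤ) - 1 := by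
          rw [← hα, hα1, Finsupp.weight_apply, Finsupp.sum_single_index (by simp)]; simp
        have hdi := hint d hd
        simp only [lazardWeight, degree_fin_two] at hwd
        push_cast at hwd
        refine ⟨d 0, hdi.1, by omega, ?_⟩
        rw [hα1]
        congr 1
        ext s; fin_cases s
        · simp
        · simp; omega
      have hdeg' : ((Finsupp.degree α : ℕ) : ℤ) = (2 : ℤ) + ((Finsupp.degree α - 2 : ℕ) : ℤ) := by
        push_cast [Nat.cast_sub hdeg]; ring
      rw [degree_fin_two]
      simp only [lazardWeight, degree_fin_two] at hle
      push_cast at hle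
      omega
    · -- an idle variable occurs: its generator vanishes, so the whole product is `0`
      obtain ⟨d', hd', hnd'⟩ : ∃ d' ∈ α.support, ¬(0 < d' 0 ∧ 0 < d' 1) := by
        by_contra hne
        exact hint fun d' hd' => by by_contra h; exact hne ⟨d', hd', h⟩
      rw [prod_eq_zero hd' (by rw [gen_of_not_interior hnd', zero_pow (Finsupp.mem_support_iff.mp hd')]), mul_zero]
      exact (genSubring m).zero_mem

/-- **The tail of a weighted homogeneous polynomial of weight `m − 1` lies in `S_{<m}`** (`m ≥ 2`): modulo the lower
subring, the class of such a polynomial in `L` is its linear part `Σ_b r_{(b,m−b)} ā_{(b,m−b)}`. [cite: Lazard1955, §III] -/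
theorem tail_mem_genSubring {m : ℕ} (hm : 2 ≤ m) {r : LazardGen}
    (hr : IsWeightedHomogeneous lazardWeight r ((m : ℤ) - 1)) : tail m r ∈ genSubring m := by
  classical
  rw [MvPolynomial.as_sum r, tail_sum]
  have _ := hm
  refine Subring.sum_mem _ fun α hα => tail_monomial_mem_genSubring ?_ _
  exact hr (MvPolynomial.mem_support_iff.mp hα)

/-! ## §3 Lazard's congruence `ā_{(i,m−i)} ≡ c_{m,i} t_m` -/

/-- A **Bezout vector** for the primitive coefficients of `C_m` (`m ≥ 2`; `0` for `m < 2`): `Σ_{b<m} w_b c_{m,b} = 1`.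
[cite: Lazard1955, §II Lemme 3] -/
def bezout (m : ℕ) : ℕ → ℤ :=
  if h : 2 ≤ m then Classical.choose (exists_sum_mul_cocycleCoeff_eq_one h) else 0

/-- The Bezout identity. [cite: Lazard1955, §II Lemme 3] -/
theorem bezout_spec {m : ℕ} (hm : 2 ≤ m) : ∑ b ∈ range m, bezout m b * (cocycleCoeff m b : ℤ) = 1 := by
  rw [bezout, dif_pos hm]; exact Classical.choose_spec (exists_sum_mul_cocycleCoeff_eq_one hm)

/-- **Lazard's generator in degree `m`**: `t_m = Σ_{0<b<m} w_b ā_{(b,m−b)} ∈ L`. [cite: Lazard1955, §II Thm. II] -/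
def tGen (m : ℕ) : LazardRing :=
  ∑ b ∈ Ioo 0 m, bezout m b • gen (Finsupp.single 0 b + Finsupp.single 1 (m - b))

/-- **Lazard's congruence**: `ā_{(i,m−i)} − c_{m,i} · t_m ∈ S_{<m}` for `0 < i < m`. [cite: Lazard1955, §III (p. 263)] -/
theorem gen_sub_smul_tGen_mem_genSubring {m i : ℕ} (hi : 0 < i) (him : i < m) :
    gen (Finsupp.single 0 i + Finsupp.single 1 (m - i)) - (cocycleCoeff m i : ℤ) • tGen m ∈ genSubring m := by
  classical
  have hm : 2 ≤ m := by omega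
  obtain ⟨r, hrI, hr⟩ := exists_mem_lazardIdeal_linPart_eq hm (bezout_spec hm) hi him
  -- pass to the weight-`(m-1)` component, still a relation, with the same linear part
  set r' := weightedHomogeneousComponent lazardWeight ((m : ℤ) - 1) r with hr'
  have hr'I : r' ∈ lazardIdeal := weightedHomogeneousComponent_mem_lazardIdeal hrI _
  have hlin : linPart m r' = linPart m r := by
    funext b
    unfold linPart
    split_ifs with hb
    · rw [hr', MvPolynomial.coeff_weightedHomogeneousComponent, if_pos]
      rw [Finsupp.weight_apply, Finsupp.sum_single_index (by simp)]
      simp only [one_smul, lazardWeight, degree_fin_two, Finsupp.coe_add, Pi.add_apply, Finsupp.single_eq_same,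
        Finsupp.single_eq_of_ne (show (0 : Fin 2) ≠ 1 by decide), Finsupp.single_eq_of_ne (show (1 : Fin 2) ≠ 0 by decide),
        add_zero, zero_add]
      push_cast; omega
    · rfl
  have htail := tail_mem_genSubring hm
    (MvPolynomial.weightedHomogeneousComponent_isWeightedHomogeneous ((m : ℤ) - 1) r)
  rw [← hr', tail, (Ideal.Quotient.eq_zero_iff_mem).mpr hr'I, zero_sub, hlin, hr] at htail
  -- evaluate the linear part `δᵢ − c_{m,i} Σ_b w_b δ_b` against the generators
  have hsum : ∑ b ∈ Ioo 0 m, ((Pi.single i 1 : ℕ → ℤ) -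
      ∑ a ∈ Ioo 0 m, ((cocycleCoeff m i : ℤ) * bezout m a) • (Pi.single a 1 : ℕ → ℤ)) b •
        gen (Finsupp.single 0 b + Finsupp.single 1 (m - b)) =
      gen (Finsupp.single 0 i + Finsupp.single 1 (m - i)) - (cocycleCoeff m i : ℤ) • tGen m := by
    have hev : ∀ b ∈ Ioo 0 m, ((Pi.single i 1 : ℕ → ℤ) -
        ∑ a ∈ Ioo 0 m, ((cocycleCoeff m i : ℤ) * bezout m a) • (Pi.single a 1 : ℕ → ℤ)) b =
        (if b = i then 1 else 0) - (cocycleCoeff m i : ℤ) * bezout m b := by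
      intro b hb
      rw [Pi.sub_apply, Pi.single_apply, Finset.sum_apply]
      simp_rw [Pi.smul_apply, Pi.single_apply, smul_eq_mul, mul_ite, mul_one, mul_zero]
      rw [sum_ite_eq (Ioo 0 m) b, if_pos hb]
    rw [sum_congr rfl fun b hb => by rw [hev b hb]]
    have hi' : i ∈ Ioo 0 m := mem_Ioo.mpr ⟨hi, him⟩
    simp only [sub_smul, sum_sub_distrib, ite_smul, one_smul, zero_smul, sum_ite_eq', hi', if_true, tGen,
      zsmul_eq_mul, Finset.mul_sum, Int.cast_mul, mul_assoc]
  rw [hsum] at htail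
  have := (genSubring m).neg_mem htail
  rwa [neg_neg] at this

/-! ## §4 The map `ℤ[T₀, T₁, …] → L`, `T_k ↦ t_{k+2}`, is surjective -/

/-- **Lazard's parametrisation** `θ : ℤ[T₀, T₁, …] → L`, `T_k ↦ t_{k+2}` (one generator in each weight `k + 1 ≥ 1`).
[cite: Lazard1955, §II Thm. II] -/
def genHom : MvPolynomial ℕ ℤ →+* LazardRing :=
  MvPolynomial.eval₂Hom (Int.castRingHom LazardRing) fun k => tGen (k + 2)

/-- `θ(T_k) = t_{k+2}`. [cite: Lazard1955, §II Thm. II] -/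
@[simp] theorem genHom_X (k : ℕ) : genHom (MvPolynomial.X k) = tGen (k + 2) := by
  simp [genHom]

/-- **Every generator `ā_d` lies in the image of `θ`** (induction on the degree `|d|`: `ā_d ≡ c · t_{|d|}` modulo the
subring generated by generators of lower degree). [cite: Lazard1955, §III (p. 263)] -/
theorem gen_mem_range_genHom (d : Fin 2 →₀ ℕ) : gen d ∈ genHom.range := by
  induction hn : Finsupp.degree d using Nat.strong_induction_on generalizing d with
  | _ n ih =>
    by_cases hd : 0 < d 0 ∧ 0 < d 1
    · -- interior of degree `n = m ≥ 2`
      have hdeg := degree_fin_two d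
      have hm : 2 ≤ n := by omega
      have hS : genSubring n ≤ genHom.range :=
        Subring.closure_le.mpr fun x ⟨d', hd', hx⟩ => hx ▸ ih _ hd' d' rfl
      have hdi : d = Finsupp.single 0 (d 0) + Finsupp.single 1 (n - d 0) := by
        ext s; fin_cases s
        · simp
        · simp; omega
      have hmem := gen_sub_smul_tGen_mem_genSubring (m := n) (i := d 0) hd.1 (by omega)
      rw [← hdi] at hmem
      have ht : tGen n ∈ genHom.range := ⟨MvPolynomial.X (n - 2), by rw [genHom_X, Nat.sub_add_cancel hm]⟩
      have := genHom.range.add_mem (hS hmem) (genHom.range.zsmul_mem ht (cocycleCoeff n (d 0) : ℤ))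
      rwa [sub_add_cancel] at this
    · rw [gen_of_not_interior hd]; exact genHom.range.zero_mem

/-- **`θ : ℤ[T] → L` is surjective**: the Lazard ring is generated by the `t_m`. [cite: Lazard1955, §II Thm. II] -/
theorem genHom_surjective : Function.Surjective genHom := by
  intro x
  obtain ⟨p, rfl⟩ := Ideal.Quotient.mk_surjective x
  suffices h : Ideal.Quotient.mk lazardIdeal p ∈ genHom.range from h
  induction p using MvPolynomial.induction_on with
  | C z => exact ⟨MvPolynomial.C z, by simp [genHom]⟩
  | add p q hp hq => rw [map_add]; exact genHom.range.add_mem hp hq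
  | mul_X p d hp => rw [map_mul]; exact genHom.range.mul_mem hp (gen_mem_range_genHom d)

end LazardRing


end Literature.RingTheory.FormalGroups
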